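import Literature.NumberTheory.EllipticCurves.Rank1Residual.ClassX1Isogeny
import Literature.NumberTheory.EllipticCurves.IsogenyQuotientCurveProofs
import Literature.NumberTheory.EllipticCurves.IsogenyVariableChangeProofs
import Literature.NumberTheory.EllipticCurves.IsogenyCompProofs
import Literature.NumberTheory.EllipticCurves.GlobalMinimalModelProofs
import Literature.NumberTheory.EllipticCurves.PastenHeightBoundsLemma68Proofs
import Literature.NumberTheory.EllipticCurves.RootNumberTwistProofs
import Literature.NumberTheory.EllipticCurves.PAdicBSDSplitMultiplicativeProofs
import Literature.NumberTheory.EllipticCurves.ModularCurveManinSemistableBridgeProofs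
import HarnessLib

/-!
# The quotient of `E/ℚ` by a rational `p`-isogeny kernel, on a globally minimal model, and the
# transports along it at a multiplicative prime (cell `b2b-bsdres`, unit `b2b-bsdres-eisenstein-p2`, gen 18)

HONEST FRAMING (run/shared/lean/b2b/bsd-rank1-residual/, verbatim in every file): the goal of the
cell is to DELETE the COMBINATION-SHAPED residual classes of the Birch–Swinnerton-Dyer formula for
ALL analytic-rank `≤ 1` elliptic curves over `ℚ` — "full BSD formula for every rank `≤ 1` curve in
class `C`" assembled STRICTLY from published theorems — so that the rank-`≤ 1` remainder becomes
exactly the CONSTRUCTION-SHAPED classes, which are TYPED (missing-input `Prop`s), NOT attempted.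
This is not "finishing BSD". Research route; NO CLAIM BEYOND STATED CLASSES; nothing here changes
a label. Theorems only; no definition, no named fact.

WHY (X2-GAP §22.3/§22.6 (iii): GV CASE 2). Greenberg–Vatsal, Invent. Math. 142 (2000), p. 28,
treat the parity case "`φ` unramified at `p` and odd" of their Thm. (1.3) by passing to the
`p`-isogenous curve `E' = E/Φ`, for which the image line `E[p]/Φ` is ramified at `p` and even
("A result of Schneider then implies that the `μ`-invariant … is unchanged by a `p`-isogeny. The
`λ`-invariant is always unchanged by an isogeny. Thus, we may assume … `φ` is ramified and even").
This file supplies the curve `E'` in the tree's vocabulary, as the first step of the kernel version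
of that reduction at a multiplicative prime `p ‖ N` (sequel files: `X2/IsogenyLineType.lean` — the
image line is ramified-even; `X2/GreenbergVatsalIsogenyReduction.lean` — the rank-`0` closure of
sub-cell X2a without the flag `GV00-mult-asserted`):

* `exists_isogeny_ker_eq_line` — for a rational line `Φ₀ ≤ E[p]` (order `p`, `Γ_ℚ`-stable) there are
  an elliptic curve over `ℚ` with a GLOBALLY MINIMAL model `W'` and a `ℚ`-isogeny `g : E → E'` with
  `ker g = Φ₀` on `ℚ̄`-points and `deg g = p` (Silverman *AEC* III.4.12 + Rem. III.4.13.2, tree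
  theorem `exists_isogeny_ker_eq_and_comp_eq_nsmul_holds`; Néron's global minimal model over `ℚ`,
  tree theorem `hasGlobalMinimalModel_rat_holds`; the change of variables as an isogeny,
  `VariableChange.toIsogeny`);
* `hasMultiplicativeReductionAtPrime_of_isIsogenous`,
  `hasSplitMultiplicativeReductionAtPrime_of_isIsogenous`, `…_iff_of_isIsogenous` — multiplicative
  and split multiplicative reduction at `p` are `ℚ`-isogeny invariants, in the `ℚ`-prime vocabulary
  of class X2 (`HasMultiplicativeReductionAtPrime`, `HasSplitMultiplicativeReductionAtPrime`), read
  off the tree's place-wise theorems (*AEC* VII.7.2 / §C.16: `a_p = ±1` and `a_p(E) = a_p(E')`).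

References: [GreenbergVatsal2000] §2 p. 28; [SilvermanAEC2009] III.4.12, III.4.13.2, VII.7.2,
VIII.8.3, §C.16; HOME/b2b-bsdres-eisenstein-p2/X2-GAP.md §23.
-/

set_option autoImplicit false

noncomputable section

open scoped Classical

open WeierstrassCurve Literature.NumberTheory.EllipticCurves
  Literature.NumberTheory.EllipticCurves.ModularForms
  Literature.NumberTheory.EllipticCurves.Rank1Residual Field IsDedekindDomain NumberField

namespace Summit.BirchSwinnertonDyer.Rank1Residual.X2.IsogenyQuotientLine

variable {W : WeierstrassCurve ℚ} [W.IsElliptic] {p : ℕ} [hp : Fact p.Prime]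

/-! ## §1. The quotient isogeny `E → E/Φ₀` onto a globally minimal model -/

omit [W.IsElliptic] in
/-- The rational line `Φ₀ ≤ E[p]` pushed into `E(ℚ̄)` has order `p`. [folklore] -/
theorem natCard_map_subtype {Φ₀ : AddSubgroup (geomTorsion W (p : ℤ))}
    (hΦ : IsRationalLine W p Φ₀) :
    Nat.card (Φ₀.map (geomTorsion W (p : ℤ)).subtype) = p := by
  have h := Nat.card_congr
    (Φ₀.equivMapOfInjective (geomTorsion W (p : ℤ)).subtype Subtype.val_injective).toEquiv
  rw [← h]
  exact hΦ.1

/-- **The quotient isogeny by a rational line, onto a globally minimal model.** For `E/ℚ` elliptic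
and `Φ₀ ≤ E[p]` a rational line (order `p`, `Γ_ℚ`-stable) there are an elliptic curve `E'/ℚ` with a
GLOBALLY MINIMAL Weierstrass model `W'` and a `ℚ`-isogeny `g : E → E'` whose kernel on
`ℚ̄`-points is exactly `Φ₀` (so `deg g = p`). Silverman *AEC* III.4.12 + Rem. III.4.13.2 (tree
theorem `exists_isogeny_ker_eq_and_comp_eq_nsmul_holds`) followed by a global minimal model of the
quotient (Néron; *AEC* VIII.8.3, tree `hasGlobalMinimalModel_rat_holds`) and the change-of-variables
isomorphism (`VariableChange.toIsogeny`). [cite: SilvermanAEC2009, Prop. III.4.12 with Rem. III.4.13.2]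
-/
theorem exists_isogeny_ker_eq_line {Φ₀ : AddSubgroup (geomTorsion W (p : ℤ))}
    (hΦ : IsRationalLine W p Φ₀) :
    ∃ (W' : WeierstrassCurve ℚ) (_ : W'.IsElliptic) (_ : W'.IsGloballyMinimal) (g : Isogeny W W'),
      g.toAddMonoidHom.ker = Φ₀.map (geomTorsion W (p : ℤ)).subtype ∧ g.degree = p := by
  set S : AddSubgroup W.geomPoints := Φ₀.map (geomTorsion W (p : ℤ)).subtype with hS
  have hScard : Nat.card S = p := natCard_map_subtype hΦ
  have hSfin : (S : Set W.geomPoints).Finite := by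
    have : Finite S := Nat.finite_of_card_ne_zero (by rw [hScard]; exact hp.out.ne_zero)
    exact Set.toFinite _
  have hSstab : ∀ (σ : absoluteGaloisGroup ℚ) (P : W.geomPoints), P ∈ S → σ • P ∈ S := by
    rintro σ _ ⟨P, hP, rfl⟩
    exact ⟨σ • P, hΦ.2 σ P hP, rfl⟩
  obtain ⟨W₀, hW₀, g₀, -, hker, -, -⟩ := W.exists_isogeny_ker_eq_and_comp_eq_nsmul_holds S hSfin hSstab
  obtain ⟨C, hC⟩ := hasGlobalMinimalModel_rat_holds W₀
  refine ⟨C • W₀, inferInstance, hC, (VariableChange.toIsogeny W₀ C).comp g₀, ?_, ?_⟩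
  · rw [Isogeny.ker_comp, VariableChange.ker_toIsogeny, AddMonoidHom.comap_bot, hker]
  · unfold Isogeny.degree
    rw [Isogeny.ker_comp, VariableChange.ker_toIsogeny, AddMonoidHom.comap_bot, hker, hScard]

/-! ## §2. Transports along a `ℚ`-isogeny at a multiplicative prime -/

section Transport

variable {W' : WeierstrassCurve ℚ} [W'.IsElliptic]

/-- **Multiplicative reduction at `p` is a `ℚ`-isogeny invariant** (`ℚ`-prime vocabulary):
Silverman *AEC* VII.7.2 / §C.16 via the tree's place-wise
`hasMultiplicativeReductionAt_of_isIsogenous`-type theorem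
(`Isogeny.hasMultiplicativeReductionAt_of_hasMultiplicativeReductionAt`) read at the place of `𝓞 ℚ`
above `p`. [cite: SilvermanAEC2009, Cor. VII.7.2 and §C.16] -/
theorem hasMultiplicativeReductionAtPrime_of_isIsogenous (h : IsIsogenous W W')
    (hmult : W.HasMultiplicativeReductionAtPrime p) : W'.HasMultiplicativeReductionAtPrime p := by
  have hpP : p.Prime := hp.out
  obtain ⟨v, hv⟩ : ∃ v : HeightOneSpectrum (𝓞 ℚ), ((Rat.HeightOneSpectrum.primesEquiv v : ℕ)) = p :=
    ⟨Rat.HeightOneSpectrum.primesEquiv.symm ⟨p, hpP⟩, by rw [Equiv.apply_symm_apply]⟩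
  subst hv
  obtain ⟨φ⟩ := h
  have hm : W.HasMultiplicativeReductionAt v :=
    (W.hasMultiplicativeReductionAtPrime_iff_hasMultiplicativeReductionAt_ringOfIntegers v).mp hmult
  exact (W'.hasMultiplicativeReductionAtPrime_iff_hasMultiplicativeReductionAt_ringOfIntegers v).mpr
    (φ.hasMultiplicativeReductionAt_of_hasMultiplicativeReductionAt hm)

/-- **Split multiplicative reduction at `p` is a `ℚ`-isogeny invariant**: `a_p = 1` (split) vs
`a_p = -1` (non-split) (*AEC* §C.16) and `a_p(E) = a_p(E')` (equal `L`-functions, Faltings /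
Knapp 11.67, tree `IsIsogenous.LFunction_eq`). [cite: SilvermanAEC2009, §C.16 (definition of L_v(T))] -/
theorem hasSplitMultiplicativeReductionAtPrime_of_isIsogenous (h : IsIsogenous W W')
    (hsplit : W.HasSplitMultiplicativeReductionAtPrime p) :
    W'.HasSplitMultiplicativeReductionAtPrime p := by
  have hpP : p.Prime := hp.out
  obtain ⟨v, hv⟩ : ∃ v : HeightOneSpectrum (𝓞 ℚ), ((Rat.HeightOneSpectrum.primesEquiv v : ℕ)) = p :=
    ⟨Rat.HeightOneSpectrum.primesEquiv.symm ⟨p, hpP⟩, by rw [Equiv.apply_symm_apply]⟩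
  subst hv
  have hmult' : W'.HasMultiplicativeReductionAtPrime (Rat.HeightOneSpectrum.primesEquiv v : ℕ) :=
    hasMultiplicativeReductionAtPrime_of_isIsogenous h hsplit.hasMultiplicativeReductionAtPrime
  have hm' : W'.HasMultiplicativeReductionAt v :=
    (W'.hasMultiplicativeReductionAtPrime_iff_hasMultiplicativeReductionAt_ringOfIntegers v).mp hmult'
  have hs : W.HasSplitMultiplicativeReductionAt v :=
    (W.hasSplitMultiplicativeReductionAtPrime_iff_hasSplitMultiplicativeReductionAt v).mp hsplit
  by_contra hns'
  have hns : ¬ W'.HasSplitMultiplicativeReductionAt v := fun h' ↦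
    hns' ((W'.hasSplitMultiplicativeReductionAtPrime_iff_hasSplitMultiplicativeReductionAt v).mpr h')
  have h1 : W.LFunction (Rat.HeightOneSpectrum.primesEquiv v) = 1 :=
    W.LFunction_apply_primesEquiv_of_hasSplitMultiplicativeReductionAt hs
  have h2 : W'.LFunction (Rat.HeightOneSpectrum.primesEquiv v) = -1 :=
    W'.LFunction_apply_primesEquiv_of_hasMultiplicativeReductionAt_of_not_split hm' hns
  have h3 : W.LFunction = W'.LFunction := h.LFunction_eq
  rw [h3, h2] at h1
  norm_num at h1

/-- The `iff` form: for `ℚ`-isogenous elliptic curves, split multiplicative reduction at `p` of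
one is split multiplicative reduction at `p` of the other. [cite: SilvermanAEC2009, §C.16 (definition of L_v(T))] -/
theorem hasSplitMultiplicativeReductionAtPrime_iff_of_isIsogenous (h : IsIsogenous W W') :
    W.HasSplitMultiplicativeReductionAtPrime p ↔ W'.HasSplitMultiplicativeReductionAtPrime p :=
  ⟨hasSplitMultiplicativeReductionAtPrime_of_isIsogenous h,
    hasSplitMultiplicativeReductionAtPrime_of_isIsogenous h.symm_of_charZero⟩

end Transport

end Summit.BirchSwinnertonDyer.Rank1Residual.X2.IsogenyQuotientLine

end
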